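import Summits.AnomalousDissipation.AnomalousDissipation.Theorems.MarginalStabilityChainStretchedVortexRowsStubCircAvgPolar
import Summits.AnomalousDissipation.AnomalousDissipation.Theorems.MarginalStabilityChainStretchedVortexRowsStubCoreRotationCoercivity
import Literature.Analysis.FluidPDE.GaussianVortexKernelRadial
import Literature.Analysis.FluidPDE.PlanarPolarCoords

/-!
# Tools for stub `stub_arnoldHighModes` (crux `CoreLinearInvertibility`,
# stmt-NavierStokesRegularity-17973, route `FilamentSkeletonRss`, line `Sketch`) — part B:
# Hardy–Wirtinger with constant `1/3` for odd functions without `k = ±1` modes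

* **Wirtinger with constant `1/3` on a circle.** For `g ∈ C¹(ℝ)` with `g(θ + π) = −g(θ)` and
  `∫_{−π}^{π} g cos = ∫_{−π}^{π} g sin = 0` (no Fourier modes `k ∈ {0, ±1, ±2, …even}` — an odd
  function carrying only the modes `|k| ≥ 3`): `∫_{−π}^{π} g² ≤ ⅓ ∫_{−π}^{π} g'²`. Elementary proof
  without Fourier series: `p = g cos` and `q = g sin` are `π`-PERIODIC with zero mean over a period,
  so the sharp Wirtinger inequality with period `π` (landed `wirtinger_periodic`) gives
  `∫ p² ≤ ¼ ∫ p'²`, `∫ q² ≤ ¼ ∫ q'²`; and `p² + q² = g²`, `p'² + q'² = g'² + g²`.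
* On the circle of radius `r`, for `φ ∈ C¹(ℝ²)` odd with vanishing `k = ±1` circle coefficients:
  `∫ φ(γ_r)² ≤ (r²/3) ∫ ‖∇φ(γ_r)‖²` (`|(φ ∘ γ_r)'| ≤ r ‖∇φ‖`).
* `Φ(r) r² ≤ 14/5` for the kernel weight `Φ = kerWeight` (`x² ≤ (7/10)(eˣ − 1)`, landed).
* **`∫ Φ(|x|) φ² ≤ (14/15) ∫ ‖∇φ‖²** with `Φ φ² ∈ L¹`, for `φ ∈ C¹` odd with vanishing `k = ±1`
  circle coefficients and `‖∇φ‖² ∈ L¹` (comparison circle by circle, landed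
  `integral_le_integral_of_forall_circle`).

References: G. H. Hardy, J. E. Littlewood, G. Pólya, *Inequalities*, Thm. 258 (Wirtinger);
Th. Gallay, V. Šverák, arXiv:2110.13739, §2.1 (the modes `|k| ≥ 2` of Arnold's form);
Th. Gallay, C. E. Wayne, J. Math. Fluid Mech. 9 (2007), proof of Prop. 3.1 (`sup r²Φ`).
-/

set_option linter.dupNamespace false

noncomputable section

namespace Summit.NavierStokesRegularity.NavierStokesRegularity.Theorems

open Set Function Filter MeasureTheory Topology Metric WithLp
open Literature.Analysis.FluidPDE
open Summit.AnomalousDissipation.AnomalousDissipation.Theorems.MarginalStabilityChainStretchedVortexRows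
open scoped InnerProductSpace RealInnerProductSpace Real

/-! ### Wirtinger with constant `1/3` -/

/-- Wirtinger for a `π`-periodic `C¹` function with zero mean over `[−π, π]`:
`∫_{−π}^{π} h² ≤ ¼ ∫_{−π}^{π} h'²` (the sharp inequality with period `π` on both half intervals). [folklore] -/
theorem highModes_wirtinger_pi_periodic {h : ℝ → ℝ} (hh : ContDiff ℝ 1 h)
    (hper : Function.Periodic h π) (hmean : ∫ x in (-π)..π, h x = 0) :
    ∫ x in (-π)..π, h x ^ 2 ≤ 1 / 4 * ∫ x in (-π)..π, deriv h x ^ 2 := by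
  -- adapted from `integral_sq_circle_le` (AnomalousDissipation toolkit)
  have hc : Continuous h := hh.continuous
  have hdc : Continuous (deriv h) := hh.continuous_deriv le_rfl
  have hii : ∀ a b, IntervalIntegrable h volume a b := fun a b => hc.intervalIntegrable _ _
  have hsplit : ∫ x in (-π)..π, h x = (∫ x in (-π)..0, h x) + ∫ x in (0:ℝ)..π, h x :=
    (intervalIntegral.integral_add_adjacent_intervals (hii _ _) (hii _ _)).symm
  have hshift : ∫ x in (-π)..0, h x = ∫ x in (0:ℝ)..π, h x := by
    have := hper.intervalIntegral_add_eq (-π) 0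
    rwa [neg_add_cancel, zero_add] at this
  have hmean0 : ∫ x in (0:ℝ)..π, h x = 0 := by linarith
  have hmean1 : ∫ x in (-π)..0, h x = 0 := by linarith
  have hW0 := wirtinger_periodic hh Real.pi_pos (by simpa using (hper 0).symm) hmean0
  have hW1 := wirtinger_periodic hh (neg_lt_zero.2 Real.pi_pos) (by simpa using (hper (-π)).symm) hmean1
  have e0 : ((π - 0) / (2 * π)) ^ 2 = 1 / 4 := by field_simp; norm_num
  have e1 : ((0 - -π) / (2 * π)) ^ 2 = 1 / 4 := by field_simp; norm_num
  rw [e0] at hW0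
  rw [e1] at hW1
  have hii2 : ∀ a b, IntervalIntegrable (fun x => h x ^ 2) volume a b := fun a b =>
    (hc.pow 2).intervalIntegrable _ _
  have hii3 : ∀ a b, IntervalIntegrable (fun x => deriv h x ^ 2) volume a b := fun a b =>
    (hdc.pow 2).intervalIntegrable _ _
  rw [← intervalIntegral.integral_add_adjacent_intervals (hii2 (-π) 0) (hii2 0 π),
    ← intervalIntegral.integral_add_adjacent_intervals (hii3 (-π) 0) (hii3 0 π)]
  linarith

/-- **Wirtinger with constant `1/3`.** For `g ∈ C¹(ℝ)` antiperiodic under `θ ↦ θ + π` with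
`∫_{−π}^{π} g cos = ∫_{−π}^{π} g sin = 0`: `∫_{−π}^{π} g² ≤ ⅓ ∫_{−π}^{π} g'²` (`p = g cos`, `q = g sin`
are `π`-periodic with zero mean; `p² + q² = g²`, `p'² + q'² = g'² + g²`). [folklore] -/
theorem highModes_wirtinger_third {g : ℝ → ℝ} (hg : ContDiff ℝ 1 g)
    (hanti : ∀ θ, g (θ + π) = -g θ)
    (hcos : ∫ θ in (-π)..π, g θ * Real.cos θ = 0)
    (hsin : ∫ θ in (-π)..π, g θ * Real.sin θ = 0) :
    ∫ θ in (-π)..π, g θ ^ 2 ≤ 1 / 3 * ∫ θ in (-π)..π, deriv g θ ^ 2 := by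
  obtain ⟨p, hp⟩ : ∃ p : ℝ → ℝ, p = fun θ => g θ * Real.cos θ := ⟨_, rfl⟩
  obtain ⟨q, hq⟩ : ∃ q : ℝ → ℝ, q = fun θ => g θ * Real.sin θ := ⟨_, rfl⟩
  have hpC : ContDiff ℝ 1 p := by rw [hp]; exact hg.mul Real.contDiff_cos
  have hqC : ContDiff ℝ 1 q := by rw [hq]; exact hg.mul Real.contDiff_sin
  have hpper : Function.Periodic p π := fun θ => by
    simp only [hp, hanti, Real.cos_add_pi]; ring
  have hqper : Function.Periodic q π := fun θ => by
    simp only [hq, hanti, Real.sin_add_pi]; ring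
  have hcos' : ∫ θ in (-π)..π, p θ = 0 := by rw [hp]; exact hcos
  have hsin' : ∫ θ in (-π)..π, q θ = 0 := by rw [hq]; exact hsin
  have hWp := highModes_wirtinger_pi_periodic hpC hpper hcos'
  have hWq := highModes_wirtinger_pi_periodic hqC hqper hsin'
  -- derivatives
  have hd : Differentiable ℝ g := hg.differentiable one_ne_zero
  have hdp : ∀ θ, deriv p θ = deriv g θ * Real.cos θ + g θ * -Real.sin θ := fun θ => by
    rw [hp]; exact ((hd θ).hasDerivAt.mul (Real.hasDerivAt_cos θ)).deriv
  have hdq : ∀ θ, deriv q θ = deriv g θ * Real.sin θ + g θ * Real.cos θ := fun θ => by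
    rw [hq]; exact ((hd θ).hasDerivAt.mul (Real.hasDerivAt_sin θ)).deriv
  have hgc : Continuous g := hg.continuous
  have hdc : Continuous (deriv g) := hg.continuous_deriv le_rfl
  have hii : ∀ {u : ℝ → ℝ}, Continuous u → ∀ a b, IntervalIntegrable (fun x => u x ^ 2) volume a b :=
    fun hu a b => (hu.pow 2).intervalIntegrable _ _
  have e1 : ∫ θ in (-π)..π, g θ ^ 2 = (∫ θ in (-π)..π, p θ ^ 2) + ∫ θ in (-π)..π, q θ ^ 2 := by
    rw [← intervalIntegral.integral_add (hii hpC.continuous _ _) (hii hqC.continuous _ _)]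
    refine intervalIntegral.integral_congr fun θ _ => ?_
    simp only [hp, hq]
    have := Real.cos_sq_add_sin_sq θ
    linear_combination (-(g θ ^ 2)) * this
  have e2 : (∫ θ in (-π)..π, deriv p θ ^ 2) + ∫ θ in (-π)..π, deriv q θ ^ 2 =
      (∫ θ in (-π)..π, deriv g θ ^ 2) + ∫ θ in (-π)..π, g θ ^ 2 := by
    rw [← intervalIntegral.integral_add (hii (hpC.continuous_deriv le_rfl) _ _)
        (hii (hqC.continuous_deriv le_rfl) _ _),
      ← intervalIntegral.integral_add (hii hdc _ _) (hii hgc _ _)]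
    refine intervalIntegral.integral_congr fun θ _ => ?_
    simp only [hdp, hdq]
    have := Real.cos_sq_add_sin_sq θ
    linear_combination (deriv g θ ^ 2 + g θ ^ 2) * this
  linarith

/-! ### The circle-wise bound -/

/-- **Circle-wise Hardy–Wirtinger with constant `1/3`.** For `φ ∈ C¹(ℝ²)` odd whose restriction to
the circle of radius `r` has vanishing `k = ±1` coefficients:
`∫_{−π}^{π} φ(γ_r)² ≤ (r²/3) ∫_{−π}^{π} ‖∇φ(γ_r)‖²`, `γ_r(θ) = (r cos θ, r sin θ)` (`φ ∘ γ_r` is antiperiodic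
under `θ ↦ θ + π` by oddness, and `|(φ ∘ γ_r)'| = |⟪∇φ, γ_r^⊥⟫| ≤ r ‖∇φ‖`). [folklore] -/
theorem highModes_sq_circle_le (φ : EuclideanSpace ℝ (Fin 2) → ℝ) (hφ : ContDiff ℝ 1 φ)
    (hodd : ∀ x, φ (-x) = -φ x) {r : ℝ}
    (hcos : ∫ θ in (-π)..π, φ (circlePt r θ) * Real.cos θ = 0)
    (hsin : ∫ θ in (-π)..π, φ (circlePt r θ) * Real.sin θ = 0) :
    ∫ θ in (-π)..π, φ (circlePt r θ) ^ 2 ≤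
      r ^ 2 / 3 * ∫ θ in (-π)..π, ‖gradient φ (circlePt r θ)‖ ^ 2 := by
  obtain ⟨g, hg⟩ : ∃ g : ℝ → ℝ, g = fun θ => φ (circlePt r θ) := ⟨_, rfl⟩
  have hγ : ContDiff ℝ 1 (fun θ : ℝ => circlePt r θ) := by
    rw [show (fun θ : ℝ => circlePt r θ) = fun θ => (r * Real.cos θ) • EuclideanSpace.single (0 : Fin 2) (1 : ℝ) +
        (r * Real.sin θ) • EuclideanSpace.single (1 : Fin 2) (1 : ℝ) from funext (circlePt_eq_smul_single r)]
    fun_prop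
  have hgC : ContDiff ℝ 1 g := by rw [hg]; exact hφ.comp hγ
  have hgd : ∀ θ, HasDerivAt g (fderiv ℝ φ (circlePt r θ) (perp (circlePt r θ))) θ := fun θ => by
    rw [hg]
    exact ((hφ.differentiable one_ne_zero) _).hasFDerivAt.comp_hasDerivAt θ (hasDerivAt_circlePt r θ)
  have hderiv : ∀ θ, deriv g θ = fderiv ℝ φ (circlePt r θ) (perp (circlePt r θ)) := fun θ => (hgd θ).deriv
  have hneg : ∀ θ, circlePt (-r) θ = -circlePt r θ := fun θ => by
    ext i; fin_cases i <;> simp [circlePt]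
  have hanti : ∀ θ, g (θ + π) = -g θ := by
    intro θ
    simp only [hg, circlePt_add_pi, hneg, hodd]
  have hcos' : ∫ θ in (-π)..π, g θ * Real.cos θ = 0 := by rw [hg]; exact hcos
  have hsin' : ∫ θ in (-π)..π, g θ * Real.sin θ = 0 := by rw [hg]; exact hsin
  have hW := highModes_wirtinger_third hgC hanti hcos' hsin'
  -- `|g'| ≤ r ‖∇φ‖`
  have hpt : ∀ θ, deriv g θ ^ 2 ≤ r ^ 2 * ‖gradient φ (circlePt r θ)‖ ^ 2 := by
    intro θ
    rw [hderiv, show fderiv ℝ φ (circlePt r θ) (perp (circlePt r θ)) =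
        ⟪gradient φ (circlePt r θ), perp (circlePt r θ)⟫ by rw [gradient, InnerProductSpace.toDual_symm_apply],
      ← sq_abs]
    have h := abs_real_inner_le_norm (gradient φ (circlePt r θ)) (perp (circlePt r θ))
    rw [Literature.Analysis.FluidPDE.norm_perp, norm_circlePt] at h
    calc |⟪gradient φ (circlePt r θ), perp (circlePt r θ)⟫| ^ 2 ≤ (‖gradient φ (circlePt r θ)‖ * |r|) ^ 2 :=
          pow_le_pow_left₀ (abs_nonneg _) h 2
      _ = r ^ 2 * ‖gradient φ (circlePt r θ)‖ ^ 2 := by rw [mul_pow, sq_abs]; ring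
  have hgrad : Continuous (gradient φ) :=
    (InnerProductSpace.toDual ℝ (EuclideanSpace ℝ (Fin 2))).symm.continuous.comp (hφ.continuous_fderiv one_ne_zero)
  have hmono : ∫ θ in (-π)..π, deriv g θ ^ 2 ≤ ∫ θ in (-π)..π, r ^ 2 * ‖gradient φ (circlePt r θ)‖ ^ 2 :=
    intervalIntegral.integral_mono_on (by linarith [Real.pi_pos])
      (((hgC.continuous_deriv le_rfl).pow 2).intervalIntegrable _ _)
      ((((hgrad.comp (continuous_circlePt r)).norm.pow 2).const_mul _).intervalIntegrable _ _) fun θ _ => hpt θ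
  rw [intervalIntegral.integral_const_mul] at hmono
  have e : ∫ θ in (-π)..π, φ (circlePt r θ) ^ 2 = ∫ θ in (-π)..π, g θ ^ 2 := by rw [hg]
  rw [e]
  calc ∫ θ in (-π)..π, g θ ^ 2 ≤ 1 / 3 * ∫ θ in (-π)..π, deriv g θ ^ 2 := hW
    _ ≤ 1 / 3 * (r ^ 2 * ∫ θ in (-π)..π, ‖gradient φ (circlePt r θ)‖ ^ 2) :=
        mul_le_mul_of_nonneg_left hmono (by norm_num)
    _ = _ := by ring

/-! ### The kernel weight against `r²` -/

/-- **`Φ(r) r² ≤ 14/5`** for the kernel weight `Φ(r) = (r²/4)/(e^{r²/4} − 1)`: with `x = r²/4`,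
`Φ r² = 4x²/(eˣ − 1) ≤ 4 · (7/10)` (`x² ≤ (7/10)(eˣ − 1)`, landed). [folklore] -/
theorem highModes_kerWeight_mul_sq_le (r : ℝ) : kerWeight r * r ^ 2 ≤ 14 / 5 := by
  rcases eq_or_ne r 0 with h | h
  · rw [h]; norm_num
  rw [kerWeight_eq h]
  have hx : 0 < r ^ 2 / 4 := by positivity
  have hex : 0 < Real.exp (r ^ 2 / 4) - 1 := by
    have := Real.add_one_lt_exp hx.ne'; linarith
  have key := sq_le_seven_tenths_mul_exp_sub_one hx.le
  rw [div_mul_eq_mul_div, div_le_iff₀ hex]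
  nlinarith

/-! ### Hardy–Wirtinger against the kernel weight -/

/-- **`∫ Φ(|x|) φ² ≤ (14/15) ∫ ‖∇φ‖²`** (and `Φ φ² ∈ L¹`) for `φ ∈ C¹(ℝ²)` odd with vanishing
`k = ±1` circle coefficients and `‖∇φ‖² ∈ L¹`: on each circle `Φ(r) ∫ φ(γ_r)² ≤ Φ(r)(r²/3) ∫ ‖∇φ(γ_r)‖²`
and `Φ(r) r² ≤ 14/5`; then the comparison principle circle by circle. [folklore] -/
theorem highModes_integral_kerWeight_mul_sq_le (φ : EuclideanSpace ℝ (Fin 2) → ℝ) (hφ : ContDiff ℝ 1 φ)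
    (hodd : ∀ x, φ (-x) = -φ x)
    (hmode : ∀ r : ℝ, 0 < r →
      ∫ θ in (-π)..π, φ (circlePt r θ) * Real.cos θ = 0 ∧
      ∫ θ in (-π)..π, φ (circlePt r θ) * Real.sin θ = 0)
    (hint : Integrable fun ξ => ‖gradient φ ξ‖ ^ 2) :
    Integrable (fun ξ => kerWeight ‖ξ‖ * φ ξ ^ 2) ∧
      ∫ ξ, kerWeight ‖ξ‖ * φ ξ ^ 2 ≤ 14 / 15 * ∫ ξ, ‖gradient φ ξ‖ ^ 2 := by
  have hΦc : Continuous fun ξ : EuclideanSpace ℝ (Fin 2) => kerWeight ‖ξ‖ :=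
    continuous_kerWeight.comp continuous_norm
  have hgrad : Continuous (gradient φ) :=
    (InnerProductSpace.toDual ℝ (EuclideanSpace ℝ (Fin 2))).symm.continuous.comp (hφ.continuous_fderiv one_ne_zero)
  have h := integral_le_integral_of_forall_circle (F₁ := fun ξ => kerWeight ‖ξ‖ * φ ξ ^ 2)
    (F₂ := fun ξ => 14 / 15 * ‖gradient φ ξ‖ ^ 2) (hΦc.mul (hφ.continuous.pow 2))
    (continuous_const.mul (hgrad.norm.pow 2))
    (fun ξ => mul_nonneg (kerWeight_pos _).le (sq_nonneg _)) (fun ξ => by positivity) (hint.const_mul _)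
    fun r hr => ?_
  · rw [integral_const_mul] at h
    exact h
  -- the circle-wise inequality
  show ∫ θ in (-π)..π, kerWeight ‖circlePt r θ‖ * φ (circlePt r θ) ^ 2 ≤
    ∫ θ in (-π)..π, 14 / 15 * ‖gradient φ (circlePt r θ)‖ ^ 2
  simp_rw [norm_circlePt, kerWeight_abs]
  rw [intervalIntegral.integral_const_mul, intervalIntegral.integral_const_mul]
  obtain ⟨hc, hs⟩ := hmode r hr
  have hA := highModes_sq_circle_le φ hφ hodd hc hs
  have hK := highModes_kerWeight_mul_sq_le r
  have hI : 0 ≤ ∫ θ in (-π)..π, ‖gradient φ (circlePt r θ)‖ ^ 2 :=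
    intervalIntegral.integral_nonneg (by linarith [Real.pi_pos]) fun θ _ => sq_nonneg _
  calc kerWeight r * ∫ θ in (-π)..π, φ (circlePt r θ) ^ 2
      ≤ kerWeight r * (r ^ 2 / 3 * ∫ θ in (-π)..π, ‖gradient φ (circlePt r θ)‖ ^ 2) :=
        mul_le_mul_of_nonneg_left hA (kerWeight_pos r).le
    _ = (kerWeight r * r ^ 2) / 3 * ∫ θ in (-π)..π, ‖gradient φ (circlePt r θ)‖ ^ 2 := by ring
    _ ≤ (14 / 5) / 3 * ∫ θ in (-π)..π, ‖gradient φ (circlePt r θ)‖ ^ 2 := by gcongr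
    _ = 14 / 15 * ∫ θ in (-π)..π, ‖gradient φ (circlePt r θ)‖ ^ 2 := by ring

/-! ### The registered tools stub -/

/-- **Registered tools stub `stub_arnoldHighModesToolsB`** (helpers for `stub_arnoldHighModes`, line
`Sketch` of crux `CoreLinearInvertibility`, stmt-NavierStokesRegularity-17973): Wirtinger with constant
`1/3` for antiperiodic `C¹` functions orthogonal to `cos, sin`; `Φ(r) r² ≤ 14/5`; and
`∫ Φ(|x|) φ² ≤ (14/15) ∫ ‖∇φ‖²` for odd `C¹` functions with vanishing `k = ±1` circle coefficients
and `‖∇φ‖² ∈ L¹`. [folklore] -/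
theorem stub_arnoldHighModesToolsB :
    (∀ g : ℝ → ℝ, ContDiff ℝ 1 g → (∀ θ, g (θ + Real.pi) = -g θ) →
      ∫ θ in (-Real.pi)..Real.pi, g θ * Real.cos θ = 0 →
      ∫ θ in (-Real.pi)..Real.pi, g θ * Real.sin θ = 0 →
      ∫ θ in (-Real.pi)..Real.pi, g θ ^ 2 ≤ 1 / 3 * ∫ θ in (-Real.pi)..Real.pi, deriv g θ ^ 2) ∧
    (∀ r : ℝ, kerWeight r * r ^ 2 ≤ 14 / 5) ∧
    (∀ φ : EuclideanSpace ℝ (Fin 2) → ℝ, ContDiff ℝ 1 φ → (∀ x, φ (-x) = -φ x) →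
      (∀ r : ℝ, 0 < r → ∫ θ in (-Real.pi)..Real.pi, φ (circlePt r θ) * Real.cos θ = 0 ∧
        ∫ θ in (-Real.pi)..Real.pi, φ (circlePt r θ) * Real.sin θ = 0) →
      Integrable (fun ξ => ‖gradient φ ξ‖ ^ 2) →
      Integrable (fun ξ => kerWeight ‖ξ‖ * φ ξ ^ 2) ∧
        ∫ ξ, kerWeight ‖ξ‖ * φ ξ ^ 2 ≤ 14 / 15 * ∫ ξ, ‖gradient φ ξ‖ ^ 2) :=
  ⟨fun _ hg hanti hcos hsin => highModes_wirtinger_third hg hanti hcos hsin, highModes_kerWeight_mul_sq_le,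
    fun φ hφ hodd hmode hint => highModes_integral_kerWeight_mul_sq_le φ hφ hodd hmode hint⟩

end Summit.NavierStokesRegularity.NavierStokesRegularity.Theorems
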